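import Mathlib.Analysis.Calculus.FDeriv.Add
import Mathlib.Analysis.Calculus.FDeriv.Comp
import Mathlib.Analysis.Calculus.FDeriv.Prod
import Mathlib.Analysis.Calculus.FDeriv.Linear
import HarnessLib

/-!
# Export algebra between a simplex and its faces, II: affine chart transitions

Topic `Literature/Topology/FourManifolds`; generalisation of `ExportAlgebra.lean` to the
secant-affine charts of the downward sweep in the smoothing of PD homeomorphisms (Munkres, Ann. of
Math. 72 (1960), §5; Campbell–D'Onofrio–Vítek (2026), §4).  When the source charts of a face `τ`
and of a coface `σ` are affine isometries and the target charts are affine, the normal part seen by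
`τ` of an `x_σ`-preserving stage output with fibre map `φ` has the form

  `N_τ (x, y) = M y + J (φ (a (x, y), C y))`

with FIXED continuous linear maps `M : F_τ → F_τ'` (the target view of the `σ`-tangential part of
the `τ`-fibre coordinate), `J : F_σ' → F_τ'` (the target view of the `σ`-fibre), `C : F_τ → F_σ`
(the `σ`-fibre coordinate of a `τ`-fibre vector) and an affine base-point map `a` (we only use its
derivative `A` at the point).  The geometry supplies: a direct-sum lower bound
`ν (‖M y‖ + ‖z‖) ≤ ‖M y + J z‖` (transversality of the target `σ`-wedge and the `σ`-fibres, and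
injectivity of `J`), a joint injectivity `‖w‖ ≤ k₁ ‖M w‖ + k₂ ‖C w‖`, and `‖A (0, w)‖ ≤ β ‖M w‖`
(the `σ`-tangential displacement of a `τ`-fibre vector is controlled by its `M`-part).  From the
pointwise exports of `σ`'s zone at the `σ`-point — (E1) `‖Dφ (e, 0)‖ ≤ X ‖e‖`, (E2)
`c ‖z‖ ≤ ‖Dφ (0, z)‖`, (E3) `‖Dφ (0, C y) − φ‖ ≤ Y` — we derive `τ`'s pointwise hypotheses:

* `tauNormalAff_fibre_lower_bound` : `ν ((1 − X β) ‖M w‖ + c ‖C w‖) ≤ ‖D N_τ (0, w)‖`;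
* `tauNormalAff_source_defect_le` : the source-form Euler defect `u` of `N_τ` has `M u = 0`,
  `A (0, u) = 0` and `c ‖C u‖ ≤ X ‖A (0, y)‖ + Y`.

Pure linear algebra plus the chain rule; the only definition is the explicit function
`tauNormalAff`; no named facts.

## References

* J. R. Munkres, *Obstructions to the smoothing of piecewise-differentiable homeomorphisms*, Ann.
  of Math. (2) 72 (1960), 521–554, §5. [Munkres1960]
* D. Campbell, L. D'Onofrio, T. Vítek, *Diffeomorphic approximation of piecewise affine
  homeomorphisms*, J. Geom. Anal. 36 (2026), §4. [CampbellDonofrioVitek2026]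
-/

noncomputable section

open Set Function Metric Filter
open scoped Topology

namespace Literature.Topology.FourManifolds

variable {Eτ : Type*} [NormedAddCommGroup Eτ] [NormedSpace ℝ Eτ]
variable {Eσ : Type*} [NormedAddCommGroup Eσ] [NormedSpace ℝ Eσ]
variable {Fτ : Type*} [NormedAddCommGroup Fτ] [NormedSpace ℝ Fτ]
variable {Fσ : Type*} [NormedAddCommGroup Fσ] [NormedSpace ℝ Fσ]
variable {Fτ' : Type*} [NormedAddCommGroup Fτ'] [NormedSpace ℝ Fτ']
variable {Fσ' : Type*} [NormedAddCommGroup Fσ'] [NormedSpace ℝ Fσ']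

/-- **The normal part seen by the face `τ` through affine chart transitions**:
`N_τ p = M p.2 + J (φ (a p, C p.2))`. [folklore] -/
def tauNormalAff (M : Fτ →L[ℝ] Fτ') (J : Fσ' →L[ℝ] Fτ') (a : Eτ × Fτ → Eσ) (C : Fτ →L[ℝ] Fσ)
    (φ : Eσ × Fσ → Fσ') (p : Eτ × Fτ) : Fτ' :=
  M p.2 + J (φ (a p, C p.2))

variable {M : Fτ →L[ℝ] Fτ'} {J : Fσ' →L[ℝ] Fτ'} {a : Eτ × Fτ → Eσ} {A : (Eτ × Fτ) →L[ℝ] Eσ}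
  {C : Fτ →L[ℝ] Fσ} {φ : Eσ × Fσ → Fσ'} {p : Eτ × Fτ}

/-- **Derivative of the `τ`-normal part**: with `L = Dφ (a p, C p.2)` and `A = Da (p)`,
`D N_τ (v, w) = M w + J (L (A (v, w), C w))`. [folklore] -/
theorem hasFDerivAt_tauNormalAff (ha : HasFDerivAt a A p) (hφ : DifferentiableAt ℝ φ (a p, C p.2)) :
    HasFDerivAt (tauNormalAff M J a C φ)
      (M.comp (ContinuousLinearMap.snd ℝ Eτ Fτ) +
        J.comp ((fderiv ℝ φ (a p, C p.2)).comp (A.prod (C.comp (ContinuousLinearMap.snd ℝ Eτ Fτ))))) p := by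
  have h1 : HasFDerivAt (fun q : Eτ × Fτ => M q.2) (M.comp (ContinuousLinearMap.snd ℝ Eτ Fτ)) p :=
    M.hasFDerivAt.comp p hasFDerivAt_snd
  have h2 : HasFDerivAt (fun q : Eτ × Fτ => (a q, C q.2)) (A.prod (C.comp (ContinuousLinearMap.snd ℝ Eτ Fτ))) p :=
    ha.prodMk (C.hasFDerivAt.comp p hasFDerivAt_snd)
  have h3 : HasFDerivAt (fun q : Eτ × Fτ => J (φ (a q, C q.2)))
      (J.comp ((fderiv ℝ φ (a p, C p.2)).comp (A.prod (C.comp (ContinuousLinearMap.snd ℝ Eτ Fτ))))) p :=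
    J.hasFDerivAt.comp p (hφ.hasFDerivAt.comp p h2)
  exact h1.add h3

/-- The fibre derivative of the `τ`-normal part:
`D N_τ (0, w) = M w + J (L (A (0, w), C w))`. [folklore] -/
theorem fderiv_tauNormalAff_apply_inr (ha : HasFDerivAt a A p) (hφ : DifferentiableAt ℝ φ (a p, C p.2))
    (w : Fτ) :
    fderiv ℝ (tauNormalAff M J a C φ) p (0, w) = M w + J (fderiv ℝ φ (a p, C p.2) (A (0, w), C w)) := by
  rw [(hasFDerivAt_tauNormalAff ha hφ).fderiv]
  rfl

/-- Splitting of a vector of `Eσ × Fσ` into its two components under a linear map. [folklore] -/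
theorem map_prod_eq_add {G : Type*} [NormedAddCommGroup G] [NormedSpace ℝ G] (L : (Eσ × Fσ) →L[ℝ] G)
    (e : Eσ) (z : Fσ) : L (e, z) = L (e, 0) + L (0, z) := by
  rw [← map_add]; congr 1; ext <;> simp

section Geometry

/-!
### The geometric hypotheses

* `hν`  — direct sum with lower bound: `ν (‖M y‖ + ‖z‖) ≤ ‖M y + J z‖`;
* `hβ`  — the `σ`-tangential displacement of a fibre vector is controlled by its `M`-part:
  `‖A (0, w)‖ ≤ β ‖M w‖`.
-/

variable {ν β : ℝ} (hν0 : 0 < ν) (hν : ∀ (y : Fτ) (z : Fσ'), ν * (‖M y‖ + ‖z‖) ≤ ‖M y + J z‖)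
  (hβ : ∀ w : Fτ, ‖A (0, w)‖ ≤ β * ‖M w‖)

include hν in
/-- In a direct sum with lower bound, `M y + J z = 0` forces `M y = 0` and `z = 0`. [folklore] -/
theorem eq_zero_of_add_eq_zero (hν0 : 0 < ν) {y : Fτ} {z : Fσ'} (h : M y + J z = 0) : M y = 0 ∧ z = 0 := by
  have h1 := hν y z
  rw [h, norm_zero] at h1
  have h2 : ‖M y‖ + ‖z‖ ≤ 0 := by
    by_contra hneg
    rw [not_le] at hneg
    have := mul_pos hν0 hneg
    linarith
  have hy : ‖M y‖ = 0 := by linarith [norm_nonneg (M y), norm_nonneg z]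
  have hz : ‖z‖ = 0 := by linarith [norm_nonneg (M y), norm_nonneg z]
  exact ⟨norm_eq_zero.1 hy, norm_eq_zero.1 hz⟩

include hν hβ in
/-- **(E2 for `τ`) Fibre lower bound.** If `σ`'s fibre map has `c ‖z‖ ≤ ‖Dφ (0, z)‖` (E2) and
`‖Dφ (e, 0)‖ ≤ X ‖e‖` (E1) at the `σ`-point, then
`ν ((1 − X β) ‖M w‖ + c ‖C w‖) ≤ ‖D N_τ (0, w)‖`. [folklore] -/
theorem tauNormalAff_fibre_lower_bound (hν0 : 0 < ν) (ha : HasFDerivAt a A p)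
    (hφ : DifferentiableAt ℝ φ (a p, C p.2)) {c X : ℝ} (hX : 0 ≤ X)
    (hE1 : ∀ e : Eσ, ‖fderiv ℝ φ (a p, C p.2) (e, 0)‖ ≤ X * ‖e‖)
    (hE2 : ∀ z : Fσ, c * ‖z‖ ≤ ‖fderiv ℝ φ (a p, C p.2) (0, z)‖) (w : Fτ) :
    ν * ((1 - X * β) * ‖M w‖ + c * ‖C w‖) ≤ ‖fderiv ℝ (tauNormalAff M J a C φ) p (0, w)‖ := by
  set L := fderiv ℝ φ (a p, C p.2) with hL
  rw [fderiv_tauNormalAff_apply_inr ha hφ, ← hL]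
  have h1 := hν w (L (A (0, w), C w))
  -- `‖L (A(0,w), C w)‖ ≥ c‖C w‖ − X‖A(0,w)‖ ≥ c‖C w‖ − Xβ‖M w‖`
  have h2 : c * ‖C w‖ - X * β * ‖M w‖ ≤ ‖L (A (0, w), C w)‖ := by
    rw [map_prod_eq_add L]
    have h3 := hE2 (C w)
    have h4 := hE1 (A (0, w))
    have h5 : ‖L (A (0, w), 0)‖ ≤ X * β * ‖M w‖ := by
      refine h4.trans ?_
      rw [mul_assoc]; exact mul_le_mul_of_nonneg_left (hβ w) hX
    have h6 : ‖L (0, C w)‖ - ‖L (A (0, w), 0)‖ ≤ ‖L (A (0, w), 0) + L (0, C w)‖ := by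
      have := norm_sub_norm_le (L (0, C w)) (-(L (A (0, w), 0)))
      rw [norm_neg, sub_neg_eq_add, add_comm] at this
      linarith [abs_le.1 (abs_norm_sub_norm_le (L (0, C w)) (-(L (A (0, w), 0))))]
    linarith
  calc ν * ((1 - X * β) * ‖M w‖ + c * ‖C w‖) = ν * (‖M w‖ + (c * ‖C w‖ - X * β * ‖M w‖)) := by ring
    _ ≤ ν * (‖M w‖ + ‖L (A (0, w), C w)‖) := by
        apply mul_le_mul_of_nonneg_left _ hν0.le
        linarith
    _ ≤ _ := h1

include hν hβ in
/-- **(E3 for `τ`) Source-form Euler defect.** If `u` solves `D N_τ (0, u) = D N_τ (0, y) − N_τ p`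
(`y = p.2`), then `M u = 0`, `A (0, u) = 0`, and `c ‖C u‖ ≤ X ‖A (0, y)‖ + Y`, where `Y` bounds the
target-form Euler defect of `σ`'s fibre map at the `σ`-point, `‖Dφ (0, C y) − φ (a p, C y)‖ ≤ Y`
(E3), and (E1), (E2) are as above. [folklore] -/
theorem tauNormalAff_source_defect_le (hν0 : 0 < ν) (ha : HasFDerivAt a A p)
    (hφ : DifferentiableAt ℝ φ (a p, C p.2)) {c X Y : ℝ}
    (hE1 : ∀ e : Eσ, ‖fderiv ℝ φ (a p, C p.2) (e, 0)‖ ≤ X * ‖e‖)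
    (hE2 : ∀ z : Fσ, c * ‖z‖ ≤ ‖fderiv ℝ φ (a p, C p.2) (0, z)‖)
    (hE3 : ‖fderiv ℝ φ (a p, C p.2) (0, C p.2) - φ (a p, C p.2)‖ ≤ Y) {u : Fτ}
    (hu : fderiv ℝ (tauNormalAff M J a C φ) p (0, u) =
      fderiv ℝ (tauNormalAff M J a C φ) p (0, p.2) - tauNormalAff M J a C φ p) :
    M u = 0 ∧ A (0, u) = 0 ∧ c * ‖C u‖ ≤ X * ‖A (0, p.2)‖ + Y := by
  set L := fderiv ℝ φ (a p, C p.2) with hL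
  rw [fderiv_tauNormalAff_apply_inr ha hφ, fderiv_tauNormalAff_apply_inr ha hφ, ← hL] at hu
  -- rewrite the equation as `M u + J (z_u − z_y) = 0`
  set zu := L (A (0, u), C u) with hzu
  set zy := L (A (0, p.2), C p.2) - φ (a p, C p.2) with hzy
  have heq : M u + J (zu - zy) = 0 := by
    have h : M u + J zu = M p.2 + J (L (A (0, p.2), C p.2)) - tauNormalAff M J a C φ p := hu
    rw [tauNormalAff] at h
    have : M u + J zu = J zy := by rw [h, hzy, map_sub]; abel
    rw [map_sub, ← add_sub_assoc, this, sub_self]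
  obtain ⟨hMu, hz⟩ := eq_zero_of_add_eq_zero hν hν0 heq
  have hAu : A (0, u) = 0 := by
    have := hβ u
    rw [hMu, norm_zero, mul_zero] at this
    exact norm_eq_zero.1 (le_antisymm this (norm_nonneg _))
  refine ⟨hMu, hAu, ?_⟩
  -- `zu = L (0, C u)` and `zu = zy`
  have hzu' : zu = L (0, C u) := by rw [hzu, hAu]
  have hzuy : zu = zy := sub_eq_zero.1 hz
  -- bound `‖zy‖ ≤ X‖A(0,y)‖ + Y`
  have hzy_le : ‖zy‖ ≤ X * ‖A (0, p.2)‖ + Y := by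
    have e : zy = L (A (0, p.2), 0) + (L (0, C p.2) - φ (a p, C p.2)) := by
      rw [hzy, map_prod_eq_add L]; abel
    rw [e]
    exact (norm_add_le _ _).trans (add_le_add (hE1 _) hE3)
  calc c * ‖C u‖ ≤ ‖L (0, C u)‖ := hE2 (C u)
    _ = ‖zy‖ := by rw [← hzu', hzuy]
    _ ≤ X * ‖A (0, p.2)‖ + Y := hzy_le

end Geometry

end Literature.Topology.FourManifolds
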